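import Literature.Analysis.FluidPDE.KatoLaiFormSolutionCalculus
import HarnessLib

/-!
# Kato–Lai in the periodic cylinder: restriction of `SymL2` to the period cell, and the skew
identity of tangential transport

Analysis/FluidPDE support file for the energy-method construction of Euler flows in the
periodic cylinder (`Literature.Analysis.FluidPDE.KatoLai1984_periodicCylinderUniformExistence`;
Kato–Lai 1984, §4 (4.10) `(F(v, w) | w)₀ = 0` for tangential solenoidal `v`, and §5, pp. 22–23).

* `cellOf V = toCell (fromTorus V)` — the `L²(cell)` class of a smooth torus field, with
  `‖cellOf V‖² ≤ 16 L ‖toL2 V‖²`;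
* `l2Field N g` — the real trigonometric polynomial with the coefficients of `g ∈ SymL2` on the
  frequency ball (`toL2 (l2Field N g) = trunc N g`), and **the restriction map**
  `cellRestrict : SymL2 (Fin 3) →L[ℝ] Lp ℝ³ 2 (cellMeasure L)`, the continuous extension of
  `toL2 V ↦ cellOf V` (`cellRestrict_toL2`), `‖cellRestrict g‖² ≤ 16 L ‖g‖²`;
* `setIntegral_inner_cylDeriv_self_eq_zero` — **(4.10)**: for `w` smooth periodic, divergence
  free in `{r < 1}` and tangential on `{r = 1}`, and `z` smooth periodic,
  `∫_cell ⟪(w·∇_K) z, z⟫ = 0`.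

Everything is proved; no named fact and no `sorry` is introduced.

## References

* T. Kato, C. Y. Lai, J. Funct. Anal. 56 (1984) 15–28, §4 (4.10), §5. [KatoLai1984]
-/

noncomputable section

open MeasureTheory Set Function Filter Topology TopologicalSpace Finset
open scoped NNReal ENNReal InnerProductSpace RealInnerProductSpace ContDiff

namespace Literature.Analysis.FluidPDE

open FunctionSpaces FunctionSpaces.Torus UnitAddTorus

/-- Local notation for physical space `ℝ³ = EuclideanSpace ℝ (Fin 3)`. -/
local notation "ℝ³" => EuclideanSpace ℝ (Fin 3)

/-- Local notation for the closed cylinder `{r ≤ 1}`. -/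
local notation "𝕂" => closure (SetLike.coe unitCylinder : Set (EuclideanSpace ℝ (Fin 3)))

namespace PeriodicCylinder

variable {L : ℝ}

/-! ### The cell class of a smooth torus field -/

/-- The `L²(cell)` class of (the pull-back of) a smooth torus field. [folklore] -/
def cellOf (L : ℝ) (V : UnitAddTorus (Fin 3) → ℝ³) : Lp ℝ³ 2 (cellMeasure L) := toCell L (fromTorus L V)

/-- `‖cellOf V‖² = ∫_cell ‖fromTorus V‖²`. [folklore] -/
theorem norm_cellOf_sq {V : UnitAddTorus (Fin 3) → ℝ³} (hV : IsSmooth V) :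
    ‖cellOf L V‖ ^ 2 = ∫ x in (cylinderCell L : Set ℝ³), ‖fromTorus L V x‖ ^ 2 := by
  have hc : ContinuousOn (fromTorus L V) 𝕂 := (contDiff_fromTorus L hV).continuous.continuousOn
  rw [cellOf, norm_toCell_eq_cellL2 hc, integral_norm_sq_eq_cellL2_sq L hc]

/-- **`‖cellOf V‖² ≤ 16 L ‖toL2 V‖²`.** [folklore] -/
theorem norm_cellOf_sq_le (hL : 0 < L) {V : UnitAddTorus (Fin 3) → ℝ³} (hV : IsSmooth V) :
    ‖cellOf L V‖ ^ 2 ≤ 16 * L * ‖toL2 hV‖ ^ 2 := by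
  rw [norm_cellOf_sq hV, norm_toL2_sq, Torus.latNormSq_zero hV]
  exact integral_cylinderCell_fromTorus_sq_le hL hV

/-- `cellOf` of a difference. [folklore] -/
theorem cellOf_sub {V V' : UnitAddTorus (Fin 3) → ℝ³} (hV : IsSmooth V) (hV' : IsSmooth V') :
    cellOf L (fun ξ => V ξ - V' ξ) = cellOf L V - cellOf L V' := by
  have hc : ContinuousOn (fromTorus L V) 𝕂 := (contDiff_fromTorus L hV).continuous.continuousOn
  have hc' : ContinuousOn (fromTorus L V') 𝕂 := (contDiff_fromTorus L hV').continuous.continuousOn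
  rw [cellOf, cellOf, cellOf, ← toCell_sub (memLp_two_cylinderCell_of_continuousOn L hc) (memLp_two_cylinderCell_of_continuousOn L hc')]
  rfl

/-- `cellOf` is additive. [folklore] -/
theorem cellOf_add {V V' : UnitAddTorus (Fin 3) → ℝ³} (hV : IsSmooth V) (hV' : IsSmooth V') :
    cellOf L (fun ξ => V ξ + V' ξ) = cellOf L V + cellOf L V' := by
  have hc : ContinuousOn (fromTorus L V) 𝕂 := (contDiff_fromTorus L hV).continuous.continuousOn
  have hc' : ContinuousOn (fromTorus L V') 𝕂 := (contDiff_fromTorus L hV').continuous.continuousOn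
  rw [cellOf, cellOf, cellOf, ← toCell_add (memLp_two_cylinderCell_of_continuousOn L hc) (memLp_two_cylinderCell_of_continuousOn L hc')]
  rfl

/-- `cellOf` is homogeneous. [folklore] -/
theorem cellOf_smul (c : ℝ) {V : UnitAddTorus (Fin 3) → ℝ³} (hV : IsSmooth V) :
    cellOf L (fun ξ => c • V ξ) = c • cellOf L V := by
  have hc : ContinuousOn (fromTorus L V) 𝕂 := (contDiff_fromTorus L hV).continuous.continuousOn
  rw [cellOf, cellOf, ← toCell_const_smul c (memLp_two_cylinderCell_of_continuousOn L hc)]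
  rfl

/-- The norm bound for a difference. [folklore] -/
theorem norm_cellOf_sub_le (hL : 0 < L) {V V' : UnitAddTorus (Fin 3) → ℝ³} (hV : IsSmooth V) (hV' : IsSmooth V') :
    ‖cellOf L V - cellOf L V'‖ ≤ Real.sqrt (16 * L) * ‖toL2 hV - toL2 hV'‖ := by
  rw [← cellOf_sub hV hV', ← toL2_sub hV hV']
  have h := norm_cellOf_sq_le hL (hV.sub hV')
  have h2 : ‖cellOf L (fun ξ => V ξ - V' ξ)‖ ^ 2 ≤ (Real.sqrt (16 * L) * ‖toL2 (hV.sub hV')‖) ^ 2 := by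
    rw [mul_pow, Real.sq_sqrt (by positivity)]; exact h
  exact (pow_le_pow_iff_left₀ (norm_nonneg _) (by positivity) two_ne_zero).1 h2

/-! ### The restriction map -/

/-- The real trigonometric polynomial with the (weight-`1`) coefficients of `g` on the ball. [folklore] -/
def l2Field (N : ℕ) (g : SymL2 (Fin 3)) : UnitAddTorus (Fin 3) → ℝ³ := realTrigPoly (freqBall N) fun k => g k

/-- It is smooth. [folklore] -/
theorem isSmooth_l2Field (N : ℕ) (g : SymL2 (Fin 3)) : IsSmooth (l2Field N g) := isSmooth_realTrigPoly _ _

/-- **`toL2 (l2Field N g) = trunc N g`.** [folklore] -/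
theorem toL2_l2Field (N : ℕ) (g : SymL2 (Fin 3)) : toL2 (isSmooth_l2Field N g) = SymL2.trunc N g := by
  refine SymL2.ext fun k => ?_
  rw [SymL2.ofSmooth_apply, l2Field, mFourierCoeff_realTrigPoly neg_mem_freqBall_of_mem g.2 k, SymL2.trunc_apply]
  simp

/-- `l2Field` is additive. [folklore] -/
theorem l2Field_add (N : ℕ) (f g : SymL2 (Fin 3)) : l2Field N (f + g) = fun ξ => l2Field N f ξ + l2Field N g ξ := by
  funext ξ
  simp only [l2Field, realTrigPoly_apply, trigPoly_apply, SymL2.add_apply, smul_add, sum_add_distrib, map_add]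

/-- `l2Field` is homogeneous. [folklore] -/
theorem l2Field_smul (N : ℕ) (c : ℝ) (g : SymL2 (Fin 3)) : l2Field N (c • g) = fun ξ => c • l2Field N g ξ := by
  funext ξ
  simp only [l2Field, realTrigPoly_apply, trigPoly_apply, SymL2.smul_apply]
  rw [← map_smul]
  congr 1
  rw [Finset.smul_sum]
  refine Finset.sum_congr rfl fun k _ => ?_
  rw [Complex.coe_smul]
  exact smul_comm _ _ _

/-- The restriction approximants are Cauchy. [folklore] -/
theorem cauchySeq_cellOf_l2Field (hL : 0 < L) (g : SymL2 (Fin 3)) : CauchySeq fun N => cellOf L (l2Field N g) := by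
  have ht : CauchySeq fun N => SymL2.trunc N g := (SymL2.tendsto_trunc g).cauchySeq
  rw [Metric.cauchySeq_iff] at ht ⊢
  intro δ hδ
  have hs : 0 < Real.sqrt (16 * L) + 1 := by positivity
  obtain ⟨N₀, hN₀⟩ := ht (δ / (Real.sqrt (16 * L) + 1)) (div_pos hδ hs)
  refine ⟨N₀, fun N hN M hM => ?_⟩
  rw [dist_eq_norm]
  have h1 := norm_cellOf_sub_le hL (isSmooth_l2Field N g) (isSmooth_l2Field M g)
  rw [toL2_l2Field, toL2_l2Field] at h1
  have h2 := hN₀ N hN M hM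
  rw [dist_eq_norm] at h2
  calc ‖cellOf L (l2Field N g) - cellOf L (l2Field M g)‖ ≤ Real.sqrt (16 * L) * ‖SymL2.trunc N g - SymL2.trunc M g‖ := h1
    _ ≤ (Real.sqrt (16 * L) + 1) * ‖SymL2.trunc N g - SymL2.trunc M g‖ := mul_le_mul_of_nonneg_right (by linarith) (norm_nonneg _)
    _ < (Real.sqrt (16 * L) + 1) * (δ / (Real.sqrt (16 * L) + 1)) := mul_lt_mul_of_pos_left h2 hs
    _ = δ := mul_div_cancel₀ δ hs.ne'

/-- The raw restriction: the limit of the cell classes of the truncations. [folklore] -/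
def cellRestrictFun (L : ℝ) (g : SymL2 (Fin 3)) : Lp ℝ³ 2 (cellMeasure L) := limUnder atTop fun N => cellOf L (l2Field N g)

/-- The approximants converge to the raw restriction. [folklore] -/
theorem tendsto_cellOf_l2Field (hL : 0 < L) (g : SymL2 (Fin 3)) :
    Tendsto (fun N => cellOf L (l2Field N g)) atTop (𝓝 (cellRestrictFun L g)) :=
  (cauchySeq_cellOf_l2Field hL g).tendsto_limUnder

/-- The raw restriction is additive. [folklore] -/
theorem cellRestrictFun_add (hL : 0 < L) (f g : SymL2 (Fin 3)) :
    cellRestrictFun L (f + g) = cellRestrictFun L f + cellRestrictFun L g := by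
  refine tendsto_nhds_unique (tendsto_cellOf_l2Field hL (f + g)) ?_
  have h := (tendsto_cellOf_l2Field hL f).add (tendsto_cellOf_l2Field hL g)
  refine h.congr fun N => ?_
  rw [l2Field_add, cellOf_add (isSmooth_l2Field N f) (isSmooth_l2Field N g)]

/-- The raw restriction is homogeneous. [folklore] -/
theorem cellRestrictFun_smul (hL : 0 < L) (c : ℝ) (g : SymL2 (Fin 3)) :
    cellRestrictFun L (c • g) = c • cellRestrictFun L g := by
  refine tendsto_nhds_unique (tendsto_cellOf_l2Field hL (c • g)) ?_
  have h := (tendsto_cellOf_l2Field hL g).const_smul c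
  refine h.congr fun N => ?_
  rw [l2Field_smul, cellOf_smul c (isSmooth_l2Field N g)]

/-- The raw restriction is bounded: `‖R g‖ ≤ √(16 L) ‖g‖`. [folklore] -/
theorem norm_cellRestrictFun_le (hL : 0 < L) (g : SymL2 (Fin 3)) : ‖cellRestrictFun L g‖ ≤ Real.sqrt (16 * L) * ‖g‖ := by
  have h := (tendsto_cellOf_l2Field hL g).norm
  refine le_of_tendsto' h fun N => ?_
  have h1 := norm_cellOf_sq_le hL (isSmooth_l2Field N g)
  rw [toL2_l2Field] at h1
  have h2 : ‖cellOf L (l2Field N g)‖ ^ 2 ≤ (Real.sqrt (16 * L) * ‖g‖) ^ 2 := by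
    rw [mul_pow, Real.sq_sqrt (by positivity)]
    exact h1.trans (mul_le_mul_of_nonneg_left (pow_le_pow_left₀ (norm_nonneg _) (SymL2.norm_trunc_le N g) 2) (by positivity))
  exact (pow_le_pow_iff_left₀ (norm_nonneg _) (by positivity) two_ne_zero).1 h2

/-- **The restriction map** `SymL2 (Fin 3) →L[ℝ] L²(cell)`. [cite: KatoLai1984, §5 (p. 22)] -/
def cellRestrict (hL : 0 < L) : SymL2 (Fin 3) →L[ℝ] Lp ℝ³ 2 (cellMeasure L) :=
  LinearMap.mkContinuous
    { toFun := cellRestrictFun L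
      map_add' := cellRestrictFun_add hL
      map_smul' := cellRestrictFun_smul hL }
    (Real.sqrt (16 * L)) (norm_cellRestrictFun_le hL)

/-- Unfolding. [folklore] -/
theorem cellRestrict_apply (hL : 0 < L) (g : SymL2 (Fin 3)) : cellRestrict hL g = cellRestrictFun L g := rfl

/-- **`R (toL2 V) = cellOf V` for smooth `V`.** [folklore] -/
theorem cellRestrict_toL2 (hL : 0 < L) {V : UnitAddTorus (Fin 3) → ℝ³} (hV : IsSmooth V) :
    cellRestrict hL (toL2 hV) = cellOf L V := by
  rw [cellRestrict_apply]
  refine tendsto_nhds_unique (tendsto_cellOf_l2Field hL (toL2 hV)) ?_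
  rw [tendsto_iff_norm_sub_tendsto_zero]
  have hb : ∀ N, ‖cellOf L (l2Field N (toL2 hV)) - cellOf L V‖ ≤ Real.sqrt (16 * L) * ‖SymL2.trunc N (toL2 hV) - toL2 hV‖ := fun N => by
    have := norm_cellOf_sub_le hL (isSmooth_l2Field N (toL2 hV)) hV
    rwa [toL2_l2Field] at this
  have ht : Tendsto (fun N => Real.sqrt (16 * L) * ‖SymL2.trunc N (toL2 hV) - toL2 hV‖) atTop (𝓝 0) := by
    have h1 := SymL2.tendsto_trunc (toL2 hV)
    rw [tendsto_iff_norm_sub_tendsto_zero] at h1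
    simpa using h1.const_mul (Real.sqrt (16 * L))
  exact squeeze_zero (fun N => norm_nonneg _) hb ht

/-- `‖R g‖² ≤ 16 L ‖g‖²`. [folklore] -/
theorem norm_cellRestrict_le (hL : 0 < L) (g : SymL2 (Fin 3)) : ‖cellRestrict hL g‖ ≤ Real.sqrt (16 * L) * ‖g‖ :=
  norm_cellRestrictFun_le hL g

/-! ### The skew identity of tangential transport on the cell -/

/-- **Kato–Lai (4.10)**: for `w` smooth periodic, divergence free in `{r < 1}` and tangential on
`{r = 1}`, and `z` smooth periodic, `∫_cell ⟪(w·∇_K) z, z⟫ = 0`. [cite: KatoLai1984, §4 (4.10)] -/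
theorem setIntegral_inner_cylDeriv_self_eq_zero (hL : 0 < L) {w z : ℝ³ → ℝ³} (hw : IsSmoothPeriodic L w) (hz : IsSmoothPeriodic L z)
    (hdiv : ∀ x ∈ (unitCylinder : Set ℝ³), VectorCalculus.divergence w x = 0)
    (hslip : ∀ x ∈ frontier (unitCylinder : Set ℝ³), ⟪w x, eR x⟫ = 0) :
    ∫ x in (cylinderCell L : Set ℝ³), ⟪cylDeriv w z x, z x⟫ = 0 := by
  -- `G = ‖z‖² • w`, `div G = 2 ⟪(w·∇)z, z⟫` on the cell, zero flux through the wall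
  set G : ℝ³ → ℝ³ := fun y => (‖z y‖ ^ 2) • w y with hG
  have hw1 : ContDiffOn ℝ 1 w 𝕂 := hw.smooth.of_le (by exact_mod_cast le_top)
  have hz1 : ContDiffOn ℝ 1 z 𝕂 := hz.smooth.of_le (by exact_mod_cast le_top)
  have hn1 : ContDiffOn ℝ 1 (fun y => ‖z y‖ ^ 2) 𝕂 := hz1.norm_sq ℝ
  have hGs : ContDiffOn ℝ 1 G 𝕂 := hn1.smul hw1
  have hGp : IsAxiallyPeriodic L G := fun x => by
    show ‖z (x + L • _)‖ ^ 2 • w (x + L • _) = ‖z x‖ ^ 2 • w x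
    rw [hz.periodic x, hw.periodic x]
  have hflux := setIntegral_divergence_cylinderCell_eq_wallFlux hL.le hGs hGp
  have hwall : ∫ y in cylWall L, ⟪G (cylCoord (Fin.insertNth 0 (1 : ℝ) y)), frameR (y 0)⟫ = 0 := by
    refine setIntegral_eq_zero_of_forall_eq_zero fun y _ => ?_
    have h0 : (Fin.insertNth 0 (1 : ℝ) y : Fin 3 → ℝ) 0 = 1 := (insertNth_zero_one_apply y).1
    have h1 : (Fin.insertNth 0 (1 : ℝ) y : Fin 3 → ℝ) 1 = y 0 := (insertNth_zero_one_apply y).2.1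
    have hfr : cylCoord (Fin.insertNth 0 (1 : ℝ) y) ∈ frontier (unitCylinder : Set ℝ³) := by
      rw [frontier_unitCylinder, mem_setOf_eq, cylRadius_cylCoord (by rw [h0]; norm_num), h0]
    have he : eR (cylCoord (Fin.insertNth 0 (1 : ℝ) y)) = frameR (y 0) := by
      rw [eR_cylCoord (by rw [h0]; norm_num), h1]
    rw [hG]
    simp only [inner_smul_left, RCLike.conj_to_real]
    rw [← he, hslip _ hfr, mul_zero]
  rw [hwall] at hflux
  -- `div G = 2 ⟪(w·∇) z, z⟫` on the cell
  have hdivG : ∀ x ∈ (cylinderCell L : Set ℝ³), VectorCalculus.divergence G x = 2 * ⟪cylDeriv w z x, z x⟫ := by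
    intro x hx
    have hxU : x ∈ (unitCylinder : Set ℝ³) := cylinderCell_le_unitCylinder L hx
    have hxr : cylRadius x < 1 := hxU
    have hzd : DifferentiableAt ℝ z x := differentiableAt_of_contDiffOn_closure hz1 hxr
    have hwd : DifferentiableAt ℝ w x := differentiableAt_of_contDiffOn_closure hw1 hxr
    have hnd : DifferentiableAt ℝ (fun y => ‖z y‖ ^ 2) x := hzd.norm_sq ℝ
    rw [hG, divergence_smul_apply hnd hwd, inner_gradient_eq_fderiv, hdiv x hxU, mul_zero, zero_add,
      cylDeriv_eq_fderiv _ _ hxU]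
    rw [hzd.hasFDerivAt.norm_sq.fderiv]
    change (2 : ℕ) • ⟪z x, fderiv ℝ z x (w x)⟫ = 2 * ⟪fderiv ℝ z x (w x), z x⟫
    rw [nsmul_eq_mul, Nat.cast_ofNat, real_inner_comm]
  have hI : ∫ x in (cylinderCell L : Set ℝ³), VectorCalculus.divergence G x = 2 * ∫ x in (cylinderCell L : Set ℝ³), ⟪cylDeriv w z x, z x⟫ := by
    rw [← integral_const_mul]
    exact setIntegral_congr_fun (cylinderCell L).isOpen.measurableSet hdivG
  rw [hI] at hflux
  linarith

end PeriodicCylinder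

end Literature.Analysis.FluidPDE
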